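import Summits.AtomisticToContinuum.Crystallization.Theses.PhononSlackCertificates

/-!
# `PeriodicGivenLayered` (stmt-AtomisticToContinuum-11779), line `Sketch`, helper for stub `stub_recurrence`:
# minimal sets and uniform return times; growth of heights; the hull is closed under translations and
# local limits

Support file for the crux `PhononSlackCertificates.PeriodicGivenLayered`, line `Sketch`, stub
`stub_recurrence` (a uniformly recurrent layered set in the hull). "The hull of `x`" (for a sequence of finite
configurations `x N : Fin N → ℝ³`) is the class of sets `S ⊆ ℝ³` such that for every radius `R` and
tolerance `ε > 0`, frequently in `N`, some translate `x N + t` is two-way `ε`-matched with `S` on the ball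
`‖·‖ ≤ R` (the clause is inlined, as in the Theses file; no definition is introduced). Contents:

* `rec_exists_uniformlyRecurrent` — Birkhoff's recurrence theorem in the form needed by the stub: for a
  `ℤ`-action on a topological space given by an explicit family of continuous maps `σ t` with
  `σ (t + u) = σ t ∘ σ u`, if the orbit closure of `x₀` is compact then it contains a point `y` with
  UNIFORM RETURN TIMES: whenever `σ j₀ y ∈ U` (`U` open), there is `G` such that from every time `m` the
  orbit of `y` visits `U` within `[m, m + G]`. Proof: Zorn's lemma gives a minimal non-empty closed
  invariant subset `M` of the orbit closure (chains have non-empty intersections by compactness); for `U`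
  open meeting `M`, `M ∖ ⋃_g σ_g⁻¹ U` is closed, invariant and proper, hence empty; a finite subcover
  bounds the return times.
* `rec_growth` — heights `z` with `z 0 = 0` and increments in `[lo, hi]`, `0 ≤ lo`, satisfy
  `lo |m| ≤ |z m| ≤ hi |m|`.
* `rec_hull_translate` — translation invariance of the hull: if `S` is in the hull and `S₂ + c ⊆ S`,
  `S - c ⊆ S₂`, then `S₂` is in the hull (enlarge the radius by `‖c‖`, shift the translation; cf.
  `IsLocalLimitOfGroundStates.image_add_const`).
* `rec_hull_of_forall_approx` — closedness of the hull under local limits: if for every `R` and `δ > 0` some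
  member of the hull is two-way `δ`-matched with `S'` on `‖·‖ ≤ R`, then `S'` is in the hull (with the
  "frequently in `N`" form no diagonal argument is needed: radius `R + ε/2`, tolerance `ε/2`).
* `rec_layeredVec_apply_two`, `rec_abs_height_le_norm`, `rec_dist_layered_eq` — for the layered points
  `A (i u + j v + L w + ζ e₃)`: the height `ζ` is the third coordinate before the linear isometry `A`, so
  `|ζ| ≤ ‖A (…)‖`, and two such points differing only in the height are at distance `|ζ₁ - ζ₂|`.

References: G. D. Birkhoff, *Dynamical Systems* (1927), Ch. VII §2 (recurrent motions in minimal sets);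
H. Furstenberg, *Recurrence in Ergodic Theory and Combinatorial Number Theory* (1981), Thm. 1.15;
M. Baake, U. Grimm, *Aperiodic Order* vol. 1 (2013), §5.4 (local topology; hulls of point sets).
-/

namespace Summit.AtomisticToContinuum.Crystallization.Theorems.LayeredHull

open Set Filter
open Literature.MathematicalPhysics.StatisticalMechanics

/-! ## Minimal sets and uniform return times -/

/-- **Birkhoff recurrence (uniform return times in a compact orbit closure).** Let `σ t`, `t ∈ ℤ`, be
continuous self-maps of a topological space with `σ (t + u) = σ t ∘ σ u`, and let the orbit closure of
`x₀` be compact. Then some `y` in the orbit closure has uniform return times: if `σ j₀ y ∈ U` with `U`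
open, there is `G : ℕ` such that for every `m : ℤ` some `g ∈ [0, G]` has `σ (m + g) y ∈ U`. (Zorn: a
minimal non-empty closed invariant subset of the orbit closure; its points are uniformly recurrent.)
[folklore] -/
theorem rec_exists_uniformlyRecurrent {X : Type*} [TopologicalSpace X] (σ : ℤ → X → X)
    (hcont : ∀ t, Continuous (σ t)) (hadd : ∀ t u x, σ (t + u) x = σ t (σ u x)) (x₀ : X)
    (hK : IsCompact (closure (Set.range fun j : ℤ => σ j x₀))) :
    ∃ y ∈ closure (Set.range fun j : ℤ => σ j x₀),
      ∀ U : Set X, IsOpen U → ∀ j₀ : ℤ, σ j₀ y ∈ U →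
        ∃ G : ℕ, ∀ m : ℤ, ∃ g : ℤ, 0 ≤ g ∧ g ≤ G ∧ σ (m + g) y ∈ U := by
  classical
  set O : Set X := closure (Set.range fun j : ℤ => σ j x₀) with hO_def
  -- the orbit closure is invariant
  have hOinv : ∀ t, MapsTo (σ t) O O := by
    intro t
    refine Set.MapsTo.closure ?_ (hcont t)
    rintro _ ⟨j, rfl⟩
    exact ⟨t + j, show σ (t + j) x₀ = σ t (σ j x₀) from hadd t j x₀⟩
  -- the family of non-empty closed invariant subsets of `O`
  set 𝒮 : Set (Set X) := {C | C ⊆ O ∧ C.Nonempty ∧ IsClosed C ∧ ∀ t, MapsTo (σ t) C C} with h𝒮_def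
  have hO𝒮 : O ∈ 𝒮 := ⟨Subset.rfl, ⟨σ 0 x₀, subset_closure ⟨0, rfl⟩⟩, isClosed_closure, hOinv⟩
  -- chains in `𝒮` have lower bounds (Cantor's intersection theorem)
  have hchain : ∀ c ⊆ 𝒮, IsChain (· ⊆ ·) c → c.Nonempty → ∃ lb ∈ 𝒮, ∀ C ∈ c, lb ⊆ C := by
    intro c hc𝒮 hc hcne
    refine ⟨⋂₀ c, ⟨?_, ?_, isClosed_sInter fun C hC => (hc𝒮 hC).2.2.1, ?_⟩,
      fun C hC => sInter_subset_of_mem hC⟩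
    · obtain ⟨C, hC⟩ := hcne
      exact (sInter_subset_of_mem hC).trans (hc𝒮 hC).1
    · haveI : Nonempty c := hcne.to_subtype
      refine IsCompact.nonempty_sInter_of_directed_nonempty_isCompact_isClosed ?_
        (fun C hC => (hc𝒮 hC).2.1) (fun C hC => hK.of_isClosed_subset (hc𝒮 hC).2.2.1 (hc𝒮 hC).1)
        (fun C hC => (hc𝒮 hC).2.2.1)
      intro C₁ hC₁ C₂ hC₂
      rcases hc.total hC₁ hC₂ with h | h
      · exact ⟨C₁, hC₁, Subset.rfl, h⟩
      · exact ⟨C₂, hC₂, h, Subset.rfl⟩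
    · intro t w hw
      exact mem_sInter.2 fun C hC => (hc𝒮 hC).2.2.2 t (mem_sInter.1 hw C hC)
  -- a minimal element
  obtain ⟨M, -, hM⟩ := zorn_superset_nonempty 𝒮 hchain O hO𝒮
  obtain ⟨hMO, ⟨y, hyM⟩, hMcl, hMinv⟩ := hM.prop
  refine ⟨y, hMO hyM, fun U hU j₀ hj₀ => ?_⟩
  -- `M` is covered by the preimages of `U`
  have hcover : M ⊆ ⋃ g : ℤ, σ g ⁻¹' U := by
    by_contra hnot
    have hVo : IsOpen (⋃ g : ℤ, σ g ⁻¹' U) := isOpen_iUnion fun g => hU.preimage (hcont g)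
    have hD : M \ ⋃ g : ℤ, σ g ⁻¹' U ∈ 𝒮 := by
      refine ⟨Set.sdiff_subset.trans hMO, ?_, hMcl.sdiff hVo, ?_⟩
      · obtain ⟨w, hwM, hwV⟩ := Set.not_subset.1 hnot
        exact ⟨w, hwM, hwV⟩
      · intro t w hw
        refine ⟨hMinv t hw.1, fun hv => hw.2 ?_⟩
        obtain ⟨g, hg⟩ := mem_iUnion.1 hv
        refine mem_iUnion.2 ⟨g + t, ?_⟩
        rw [mem_preimage] at hg ⊢
        rwa [hadd]
    have hDM : M \ ⋃ g : ℤ, σ g ⁻¹' U = M := hM.eq_of_subset hD Set.sdiff_subset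
    have hmem : σ j₀ y ∈ M \ ⋃ g : ℤ, σ g ⁻¹' U := by
      rw [hDM]
      exact hMinv j₀ hyM
    refine hmem.2 (mem_iUnion.2 ⟨0, ?_⟩)
    rw [mem_preimage, ← hadd, zero_add]
    exact hj₀
  -- a finite subcover bounds the return times
  obtain ⟨T, hT⟩ := (hK.of_isClosed_subset hMcl hMO).elim_finite_subcover (fun g : ℤ => σ g ⁻¹' U)
    (fun g => hU.preimage (hcont g)) hcover
  obtain ⟨G₀, hG₀⟩ : ∃ G₀ : ℕ, G₀ = T.sup Int.natAbs := ⟨_, rfl⟩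
  refine ⟨2 * G₀, fun m => ?_⟩
  have hw : σ (m + (G₀ : ℤ)) y ∈ M := hMinv _ hyM
  obtain ⟨g, hgT, hg⟩ := mem_iUnion₂.1 (hT hw)
  have hgabs : g.natAbs ≤ G₀ := hG₀ ▸ Finset.le_sup (f := Int.natAbs) hgT
  have hg1 : -(G₀ : ℤ) ≤ g := by omega
  have hg2 : g ≤ (G₀ : ℤ) := by omega
  refine ⟨g + (G₀ : ℤ), by omega, by push_cast; omega, ?_⟩
  rw [mem_preimage] at hg
  rw [show m + (g + (G₀ : ℤ)) = g + (m + (G₀ : ℤ)) by ring, hadd]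
  exact hg

/-! ## Heights with increments in a box -/

/-- Heights with `z 0 = 0` and increments in `[lo, hi]` (`0 ≤ lo`) grow linearly:
`lo |m| ≤ |z m| ≤ hi |m|`. [folklore] -/
theorem rec_growth {z : ℤ → ℝ} {lo hi : ℝ} (h0 : z 0 = 0) (hlo : 0 ≤ lo)
    (h : ∀ m : ℤ, lo ≤ z (m + 1) - z m ∧ z (m + 1) - z m ≤ hi) (m : ℤ) :
    lo * |(m : ℝ)| ≤ |z m| ∧ |z m| ≤ hi * |(m : ℝ)| := by
  have hup : ∀ n : ℕ, lo * n ≤ z n ∧ z n ≤ hi * n := by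
    intro n
    induction n with
    | zero => simp [h0]
    | succ n ih =>
      have := h n
      push_cast
      constructor <;> linarith [ih.1, ih.2]
  have hdown : ∀ n : ℕ, lo * n ≤ -z (-(n : ℤ)) ∧ -z (-(n : ℤ)) ≤ hi * n := by
    intro n
    induction n with
    | zero => simp [h0]
    | succ n ih =>
      have := h (-(n : ℤ) - 1)
      rw [show -(n : ℤ) - 1 + 1 = -(n : ℤ) by ring] at this
      rw [show -((n + 1 : ℕ) : ℤ) = -(n : ℤ) - 1 by push_cast; ring]
      push_cast
      constructor <;> linarith [ih.1, ih.2]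
  rcases le_or_gt 0 m with hm | hm
  · obtain ⟨n, rfl⟩ := Int.eq_ofNat_of_zero_le hm
    have h1 := hup n
    have hn0 : (0 : ℝ) ≤ n := n.cast_nonneg
    have hz0 : 0 ≤ z n := le_trans (mul_nonneg hlo hn0) h1.1
    rw [Int.cast_natCast, abs_of_nonneg hn0, abs_of_nonneg hz0]
    exact h1
  · obtain ⟨n, rfl⟩ := Int.exists_eq_neg_ofNat hm.le
    have h1 := hdown n
    have hn0 : (0 : ℝ) ≤ n := n.cast_nonneg
    have hz0 : z (-(n : ℤ)) ≤ 0 := by linarith [mul_nonneg hlo hn0, h1.1]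
    rw [Int.cast_neg, Int.cast_natCast, abs_neg, abs_of_nonneg hn0, abs_of_nonpos hz0]
    exact h1

/-! ## Translation invariance and closedness of the hull -/

section Hull

variable {E : Type*} [NormedAddCommGroup E]

/-- **The hull is translation invariant.** If `S` is in the hull of `x` and `S₂` is the translate `S - c`
(in the two-inclusion form `S₂ + c ⊆ S`, `S - c ⊆ S₂`), then `S₂` is in the hull of `x`: match at radius
`R + ‖c‖` and shift the translation by `-c` (stated in any normed group). [folklore] -/
theorem rec_hull_translate (x : (N : ℕ) → (Fin N → E)) {S S₂ : Set E} (c : E)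
    (hS : ∀ R ε : ℝ, 0 < ε → ∃ᶠ N in atTop, ∃ t : E,
      (∀ p ∈ S, ‖p‖ ≤ R → ∃ i : Fin N, dist (x N i + t) p ≤ ε) ∧
      (∀ i : Fin N, ‖x N i + t‖ ≤ R → ∃ p ∈ S, dist (x N i + t) p ≤ ε))
    (h₁ : ∀ p ∈ S₂, p + c ∈ S) (h₂ : ∀ q ∈ S, q - c ∈ S₂) :
    ∀ R ε : ℝ, 0 < ε → ∃ᶠ N in atTop, ∃ t : E,
      (∀ p ∈ S₂, ‖p‖ ≤ R → ∃ i : Fin N, dist (x N i + t) p ≤ ε) ∧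
      (∀ i : Fin N, ‖x N i + t‖ ≤ R → ∃ p ∈ S₂, dist (x N i + t) p ≤ ε) := by
  intro R ε hε
  refine (hS (R + ‖c‖) ε hε).mono fun N hN => ?_
  obtain ⟨τ, hA, hB⟩ := hN
  refine ⟨τ - c, fun p hp hpR => ?_, fun i hi => ?_⟩
  · have hpc : ‖p + c‖ ≤ R + ‖c‖ := (norm_add_le p c).trans (by linarith)
    obtain ⟨i, hi⟩ := hA (p + c) (h₁ p hp) hpc
    refine ⟨i, ?_⟩
    rw [dist_eq_norm] at hi ⊢
    convert hi using 2
    abel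
  · have hic : ‖x N i + τ‖ ≤ R + ‖c‖ := by
      have : ‖x N i + τ‖ ≤ ‖x N i + (τ - c)‖ + ‖c‖ :=
        calc ‖x N i + τ‖ = ‖x N i + (τ - c) + c‖ := by congr 1; abel
          _ ≤ ‖x N i + (τ - c)‖ + ‖c‖ := norm_add_le _ _
      linarith
    obtain ⟨q, hq, hiq⟩ := hB i hic
    refine ⟨q - c, h₂ q hq, ?_⟩
    rw [dist_eq_norm] at hiq ⊢
    convert hiq using 2
    abel

/-- **The hull is closed under local limits.** If for every radius `R` and every `δ > 0` some set `S₁` in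
the hull of `x` is two-way `δ`-matched with `S'` on the ball `‖·‖ ≤ R`, then `S'` is in the hull of `x`
(radius `R + ε/2`, tolerance `ε/2`, triangle inequality; the "frequently in `N`" form needs no diagonal
argument; stated in any normed group). [folklore] -/
theorem rec_hull_of_forall_approx (x : (N : ℕ) → (Fin N → E)) {S' : Set E}
    (h : ∀ R δ : ℝ, 0 < δ → ∃ S₁ : Set E,
      (∀ R ε : ℝ, 0 < ε → ∃ᶠ N in atTop, ∃ t : E,
        (∀ p ∈ S₁, ‖p‖ ≤ R → ∃ i : Fin N, dist (x N i + t) p ≤ ε) ∧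
        (∀ i : Fin N, ‖x N i + t‖ ≤ R → ∃ p ∈ S₁, dist (x N i + t) p ≤ ε)) ∧
      (∀ p ∈ S', ‖p‖ ≤ R → ∃ q ∈ S₁, dist p q ≤ δ) ∧
      (∀ q ∈ S₁, ‖q‖ ≤ R → ∃ p ∈ S', dist q p ≤ δ)) :
    ∀ R ε : ℝ, 0 < ε → ∃ᶠ N in atTop, ∃ t : E,
      (∀ p ∈ S', ‖p‖ ≤ R → ∃ i : Fin N, dist (x N i + t) p ≤ ε) ∧
      (∀ i : Fin N, ‖x N i + t‖ ≤ R → ∃ p ∈ S', dist (x N i + t) p ≤ ε) := by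
  intro R ε hε
  have hε2 : 0 < ε / 2 := half_pos hε
  obtain ⟨S₁, hS₁, h1, h2⟩ := h (R + ε / 2) (ε / 2) hε2
  refine (hS₁ (R + ε / 2) (ε / 2) hε2).mono fun N hN => ?_
  obtain ⟨τ, hA, hB⟩ := hN
  refine ⟨τ, fun p hp hpR => ?_, fun i hi => ?_⟩
  · obtain ⟨q, hq, hpq⟩ := h1 p hp (by linarith)
    have hqR : ‖q‖ ≤ R + ε / 2 := by
      have h' : ‖q‖ ≤ ‖p‖ + dist p q := by
        rw [dist_comm, dist_eq_norm]
        linarith [norm_sub_norm_le q p]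
      linarith
    obtain ⟨i, hi⟩ := hA q hq hqR
    refine ⟨i, ?_⟩
    calc dist (x N i + τ) p ≤ dist (x N i + τ) q + dist q p := dist_triangle _ _ _
      _ ≤ ε / 2 + ε / 2 := add_le_add hi (by rwa [dist_comm])
      _ = ε := by ring
  · obtain ⟨q, hq, hiq⟩ := hB i (by linarith)
    have hqR : ‖q‖ ≤ R + ε / 2 := by
      have h' : ‖q‖ ≤ ‖x N i + τ‖ + dist (x N i + τ) q := by
        rw [dist_comm, dist_eq_norm]
        linarith [norm_sub_norm_le q (x N i + τ)]
      linarith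
    obtain ⟨p, hp, hqp⟩ := h2 q hq hqR
    refine ⟨p, hp, ?_⟩
    calc dist (x N i + τ) p ≤ dist (x N i + τ) q + dist q p := dist_triangle _ _ _
      _ ≤ ε / 2 + ε / 2 := add_le_add hiq hqp
      _ = ε := by ring

end Hull

/-! ## Heights of layered points -/

/-- The third coordinate of `i u + j v + L w + ζ e₃` is the height `ζ` (`u, v, w` are horizontal).
[folklore] -/
theorem rec_layeredVec_apply_two (a i j L ζ : ℝ) :
    ((i • triangularVec₁ a) + (j • triangularVec₂ a) + (L • barlowOffset a) + (ζ • layerNormal 1)) 2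
      = ζ := by
  simp [triangularVec₁, triangularVec₂, barlowOffset, layerNormal]

/-- The height is bounded by the norm of the layered point: `|ζ| ≤ ‖A (i u + j v + L w + ζ e₃)‖` for a
linear isometry `A` of `ℝ³`. [folklore] -/
theorem rec_abs_height_le_norm (A : EuclideanSpace ℝ (Fin 3) →ₗᵢ[ℝ] EuclideanSpace ℝ (Fin 3))
    (a i j L ζ : ℝ) :
    |ζ| ≤ ‖A ((i • triangularVec₁ a) + (j • triangularVec₂ a) + (L • barlowOffset a) +
      (ζ • layerNormal 1))‖ := by
  rw [A.norm_map]
  have := PiLp.norm_apply_le ((i • triangularVec₁ a) + (j • triangularVec₂ a) +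
    (L • barlowOffset a) + (ζ • layerNormal 1)) 2
  rwa [rec_layeredVec_apply_two, Real.norm_eq_abs] at this

/-- Two layered points of `ℝ³` with the same horizontal part are at distance the difference of their
heights (`‖e₃‖ = 1`). [folklore] -/
theorem rec_dist_layered_eq (A : EuclideanSpace ℝ (Fin 3) →ₗᵢ[ℝ] EuclideanSpace ℝ (Fin 3))
    (b : EuclideanSpace ℝ (Fin 3)) (ζ₁ ζ₂ : ℝ) :
    dist (A (b + ζ₁ • layerNormal 1)) (A (b + ζ₂ • layerNormal 1)) = |ζ₁ - ζ₂| := by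
  have hn : ‖(layerNormal 1 : EuclideanSpace ℝ (Fin 3))‖ = 1 := by
    rw [EuclideanSpace.norm_eq, Fin.sum_univ_three]
    simp [layerNormal]
  rw [A.dist_map, dist_add_left, dist_eq_norm, ← sub_smul, norm_smul, hn, mul_one, Real.norm_eq_abs]

end Summit.AtomisticToContinuum.Crystallization.Theorems.LayeredHull
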